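import Summits.QuantumFields.BalabanUV.Beta.GAN24.WardRemainderEndThreeSplit
import Summits.QuantumFields.BalabanUV.Beta.GAN24.LayerTransportLiteralSocket
import Summits.QuantumFields.BalabanUV.Beta.GAN24.ChainTableLegTelescopeCell

/-!
# `BalabanUV.Beta.GAN24.WardRemainderEndThreeCoDress` — binder row G-an2-4 ∕ (CONV-C), W-slot CT-W, route «WC-TL» ∕ (Q-R) «QR-LL»: **THE (Q-R)^{cc} RE-CUT OF THE SPLIT
# END** — the per-sub-letter layer bound `hLT` is required ONLY on a displayed GOOD set of sub-labels; the transported BAD sub-letters are carried as an EXPLICIT displayed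
# remainder `DL_n(Y)` (row (DIV)); + the table one-gauge cell of the literal socket GONE on co-closed letters (row (CC), leaf-01 g67's `ChainTableLegTelescopeCell` BY NAME)
# (row owner `b2b-balaban-gan24-p1`, gen 30; RULING R-gan24p1-g29-2 (4), journal l.45244; design `HOME/b2b-balaban-gan24-p1/gen29/QR-CC-DESIGN-v0.md` v0.2 §2)

NOT IN PRINT; OUR BOOKKEEPING ([folklore] re-assembly BY NAME of the owner's split END `WardRemainderEndThreeSplit` (p329621): `transport_unitS_blockSum_split` (the sub-letter split is a
theorem), `biLoc_of_profile_block`, `WardRemainderRows.good_sum_range_of_geometric ∕ wLocStencil_good` (the subadditive size class), `WardResidualSUnits.unitS_duhamel_blockSum_comb`,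
`WardRemainderTransportedLetter.transport_unitStepMap_eq_cubic_push₃`, an1's `KernelWard.biLoc_finset_sum`, `Finset.sum_filter_add_sum_filter_not`; §4: leaf-01's
`LayerTransportLiteralSocket.exists_hLT_literal_of_gauge_cells` ⨾ `ChainTableLegTelescopeCell.biLoc_smul_push₃_chainGauge_of_divFree`; 0 cited facts, 0 `def`, 0 `def … : Prop`,
0 sorry).  HONEST FRAMING (cell contract, verbatim): «discharging `BetaPertH` makes Bałaban's UV stability UNCONDITIONAL — a real constructive-QFT result; it is NOT the continuum
limit and NOT the Clay problem.»  HONEST DEPENDENCY (verbatim): «continuum YM on T⁴ ⇐ BetaPertH ∧ nine spine estimates (0/9 proved); BetaPertH ⇐ (D1) ∧ (D4) ∧ CAP+tail; G-an2-4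
gates asym, D1 and NE2/3/4.»

WHY.  The split END `wLocStencil_unitS_split_three` displays ONE layer bound `hLT` per transported sub-letter `T_{m,k,v}` (`v ∈ box Lc`, `m + k + 2 = n`).  RULING R-gan24p1-g29-2:
for the DRESSED literal at `d = 3` that display is NOT suppliable on the sub-letters whose born letter carries a PERSISTENT face flux (the boundary flux tower, `BoundaryFluxRecursion` +
(L3) `TableSlotCoDressCharge`: density gain `C·Lc^{d−2}` per level — NEGATIVE-BY-COUNT, leaf-01 g67 R-1), while it survives EXACTLY on co-closed ∕ flux-free sub-letters
(`TableSlotCoDress` §4–§5, `ChainTableLegCoClosed`, `ChainTableLegTelescopeCell`).  THIS FILE re-cuts the END accordingly, WITHOUT choosing the good set: for ANY displayed predicate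
`G m v` on (level, sub-label), `hLT` is asked only where `G m v` holds, and the conclusion bounds `unitS_n (Φ n Y) − DL_n(Y)` with the SAME level-free constant, where
`DL_n(Y) := Σ_{m < n, m+2 ≤ n} Σ_{v ∈ box Lc, ¬G m v} transport (unitStepMap Lc ρ Lc^{d+1}) (m+1) (n−1−m) (unitS_{m+1} T_{m,n−2−m,v})` is the finite sum of the transported BAD
sub-letters — displayed by an equation hypothesis `hDL` (instantiate with `rfl`), a closed-form expression in tree objects (row (DIV): «R̃_n = R̃_n^{cc} + DL_n»).  With `G ≡ True`
the bad sum is empty and the split END is recovered.  The intended instance (QR-CC-DESIGN §1): `G m v` ⇔ the born sub-letter at `(m, v)` is flux-free after its non-persistent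
pushes (interior and non-persistent-face labels); `¬G` = the persistent-face sub-letters = the DL tower, handed to the (CONV-C) END as the new displayed binder (DL) (an2 g41 W4:
read through ONE pairing — the tadpole against the co-dressed leg — and converted into coarse multiplier-leg block-flux words by `RelInvWardPairing.ward_pairing`; to be PRICED).

WHAT.  §1 `sum_filter_sub` ([folklore] `Σ_s f − Σ_{s, ¬p} f = Σ_{s, p} f`), `card_filter_le_real`; §2 **`wLocStencil_unitS_of_layer_coDress`** (generic `d`, ratio `θ ∈ [0,1)`): the rows of
`WardRemainderEndThreeSplit.wLocStencil_unitS_of_layer_split` VERBATIM except `hLT … → G m v → …`, plus `hDL` ⊢ `∀ κ′ u, BiLoc ((unitS_n (Φ n Y) − DL) κ′ u) u u ((C₀ + C·(1 − θ)⁻¹)·e^{−η‖(Lc:ℤ)•Y − u‖₁}) (κ∕4)`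
with `C = #box(Lc)·e^{δ((d+1)Lc+1)}·(K + Cs·(d+1)·2·#box(Lc))` — level-free, the split END's; §3 **`wLocStencil_unitS_coDress_three`** (`d = 3`, `θ = (√Lc)⁻¹`, `hLT` in leaf-01's
literal-socket currency `K·(√(Lc^(k+1)))⁻¹`); §4 **`exists_hLT_literal_of_kernel_cells_of_divFree`** (row (CC), `d = 3`): on a CO-CLOSED letter (`divV S ≡ 0`, slot-summable) leaf-01's
literal socket needs only the TWO KERNEL one-gauge cells `push₃ (T−U) T T S`, `push₃ U (T−U) T S` — the table cell `push₃ U U (T−U) S` is the zero kernel (`K₃ = 0`,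
`ChainTableLegTelescopeCell.biLoc_smul_push₃_chainGauge_of_divFree`), the pure cell (UUU) is DISCHARGED there (`LayerTransportUndressedThree`) modulo the letter-side rows.
Discharges NOTHING of (Q-R) ∕ (LT) ∕ (LAY) ∕ (S) ∕ (DIV) ∕ (DL) by itself: NO bound on `DL_n` is claimed (none is expected at `d = 3` for the dressed literal); the two kernel cells of
§4 are DISPLAYED ((ii-G)'s objects); NEVER «G-an2-4 closed» as (CONV-C); NOT D1, NOT `BetaPertH`, NOT continuum, NOT Clay.  2026-08-22; no existing file touched.
-/

noncomputable section

open Finset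
open scoped BigOperators
open Literature.MathematicalPhysics.QuantumFieldTheory
open Literature.MathematicalPhysics.QuantumFieldTheory.Balaban1983to89
open Literature.MathematicalPhysics.QuantumFieldTheory.Balaban1983to89.Beta
open B12Sec2to5 (l1 l1_nonneg)
open B6BondElimination (unitVec)
open ExpKernelCalculus (MKer Site BiLoc Zl l1_sub_triangle l1_sub_symm)
open KernelWard (biLoc_finset_sum divV)
open OneStepResolventKernel (Fib LocStencil)
open OneStepKernelFamily (KInvStep)
open LatticeForm (quo)
open AffineAveraging (box toSite)
open BalabanStepJetsSucc (wE)
open BalabanCompositeJets (respStep)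
open StepJetData (biLoc_weaken l1_unitVec)
open Summit.QuantumFields.BalabanUV.Beta.SpineRooted (e3OfK)
open Summit.QuantumFields.BalabanUV.Beta.AxialDressingRooted (coDressKBmAt)
open Summit.QuantumFields.BalabanUV.Beta.HessKerDressedUnits (unitS locStencil_unitS)
open Summit.QuantumFields.BalabanUV.Beta.GAN24.CombesThomas (sfStep smStep sfStep_ne_zero smStep_ne_zero)
open Summit.QuantumFields.BalabanUV.Beta.GAN24.Push4 (IsFF)
open Summit.QuantumFields.BalabanUV.Beta.GAN24.Push4Iter (LegFam legChain)
open Summit.QuantumFields.BalabanUV.Beta.GAN24.Push3 (push₃)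
open Summit.QuantumFields.BalabanUV.Beta.GAN24.RespStepBmDecompExact (respStepBmSeq)
open Summit.QuantumFields.BalabanUV.Beta.GAN24.SrecBornSector (unitStepMap)
open Summit.QuantumFields.BalabanUV.Beta.GAN24.AffineUnroll (transport transport_zero)
open Summit.QuantumFields.BalabanUV.Beta.GAN24.WardResidualSUnits (unitS_duhamel_blockSum_comb)
open Summit.QuantumFields.BalabanUV.Beta.GAN24.WardRemainderRows (good_sum_range_of_geometric wLocStencil_good)
open Summit.QuantumFields.BalabanUV.Beta.GAN24.WardRemainderTransportedLetter (transport_unitStepMap_eq_cubic_push₃ locStencil_of_profile inv_sqrt_natCast_pow)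
open Summit.QuantumFields.BalabanUV.Beta.GAN24.WardRemainderEndThreeSplit (l1_toSite_le biLoc_of_profile_block isLoc_of_isLoc_unitS transport_unitS_blockSum_split)
open Summit.QuantumFields.BalabanUV.Beta.GAN24.LayerTransportLiteralSocket (exists_hLT_literal_of_gauge_cells)
open Summit.QuantumFields.BalabanUV.Beta.GAN24.ChainTableLegTelescopeCell (biLoc_smul_push₃_chainGauge_of_divFree)

namespace Summit.QuantumFields.BalabanUV.Beta.GAN24.WardRemainderEndThreeCoDress

variable {d Lc : ℕ}

/-! ## §1 Two finite-sum facts -/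

/-- [folklore] `Σ_{s} f − Σ_{s, ¬p} f = Σ_{s, p} f`. -/
theorem sum_filter_sub {ι M : Type*} [AddCommGroup M] (s : Finset ι) (p : ι → Prop) [DecidablePred p] (f : ι → M) :
    (∑ i ∈ s, f i) - ∑ i ∈ s.filter (fun i => ¬ p i), f i = ∑ i ∈ s.filter p, f i := by
  rw [← Finset.sum_filter_add_sum_filter_not s p f, add_sub_cancel_right]

/-- [folklore] `#(s.filter p) ≤ #s`, real form. -/
theorem card_filter_le_real {ι : Type*} (s : Finset ι) (p : ι → Prop) [DecidablePred p] :
    ((s.filter p).card : ℝ) ≤ (s.card : ℝ) := by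
  exact_mod_cast Finset.card_filter_le s p

/-! ## §2 THE RE-CUT END (generic `d`, ratio `θ`): `hLT` on the good sub-letters only, the bad ones displayed as `DL` -/

section CoDress

variable [NeZero Lc]

/-- NOT IN PRINT; OUR BOOKKEEPING.  **THE (Q-R)^{cc} RE-CUT OF THE SPLIT END**, generic `d`, ratio `θ ∈ [0,1)`.  Rows: (REP) `hunroll ∕ hΦ0`, (LAY) `hS0 ∕ hω0` (untransported level),
`hff ∕ hS ∕ hω` per sub-letter `T_{m,k,v} = unitS_{m+1}(Σ_{w∈box(Lc^k)} σ m (Lc^k•(Lc•Y + toSite v) + toSite w))` — ALL VERBATIM the split END's; (LT) `hLT` per sub-letter in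
leaf-01's `(L = Lc^(k+1), y_v)` cell currency, asked ONLY for `G m v`; (DIV) `hDL`: `DL = Σ_{m ∈ range n, m+2 ≤ n} Σ_{v ∈ box Lc, ¬G m v} transport (unitStepMap Lc ρ Lc^{d+1}) (m+1) (n−1−m) T_{m,n−2−m,v}`
(the transported BAD sub-letters; `rfl` instantiates it).  Conclusion: `∀ κ′ u, BiLoc ((unitS_n (Φ n Y) − DL) κ′ u) u u ((C₀ + #box(Lc)·e^{δ((d+1)Lc+1)}·(K + Cs·(d+1)·2·#box(Lc))·(1 − θ)⁻¹)·e^{−min(κ∕2,δ∕2)‖Lc•Y − u‖₁}) (κ∕4)`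
— the split END's constant, UNIFORM IN `n`; NO bound on `DL` claimed. -/
theorem wLocStencil_unitS_of_layer_coDress {rr : Fin (d + 1) → ℕ} (hrr : rr ∈ box (d + 1) Lc)
    (G : ℕ → (Fin (d + 1) → ℕ) → Prop) [∀ m, DecidablePred (G m)]
    {Φ σ : ℕ → (Fin (d + 1) → ℤ) → Fin (d + 1) → (Fin (d + 1) → ℤ) → MKer (d + 1) (Fib d)} (n : ℕ) (Y : Fin (d + 1) → ℤ)
    {ω0 : ℕ → (Fin (d + 1) → ℤ) → ℝ} {ω : ℕ → (Fin (d + 1) → ℕ) → (Fin (d + 1) → ℤ) → ℝ} {Cs κ m' δ K C₀ θ : ℝ}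
    (hκ : 0 < κ) (hm : κ < m') (hδ : 0 < δ) (hCs : 0 ≤ Cs) (hK : 0 ≤ K) (hθ0 : 0 ≤ θ) (hθ1 : θ < 1)
    (hunroll : Φ n Y =
      transport (fun j (S : Fin (d + 1) → (Fin (d + 1) → ℤ) → MKer (d + 1) (Fib d)) =>
          fun κ' u' => ((Lc : ℝ) ^ (d + 1) * wE d Lc (j + 1)) • e3OfK Lc (coDressKBmAt (toSite rr) Lc (KInvStep (d := d) Lc j)) S κ' u') 0 n
          (∑ w ∈ box (d + 1) (Lc ^ n), Φ 0 (((Lc ^ n : ℕ) : ℤ) • Y + toSite w))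
      + ∑ m ∈ Finset.range n,
          transport (fun j (S : Fin (d + 1) → (Fin (d + 1) → ℤ) → MKer (d + 1) (Fib d)) =>
              fun κ' u' => ((Lc : ℝ) ^ (d + 1) * wE d Lc (j + 1)) • e3OfK Lc (coDressKBmAt (toSite rr) Lc (KInvStep (d := d) Lc j)) S κ' u') (m + 1) (n - 1 - m)
            (∑ w ∈ box (d + 1) (Lc ^ (n - 1 - m)), σ m (((Lc ^ (n - 1 - m) : ℕ) : ℤ) • Y + toSite w)))
    (hΦ0 : ∀ κ' u, BiLoc (transport (unitStepMap Lc (toSite rr) ((Lc : ℝ) ^ (d + 1))) 0 n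
          (unitS (sfStep Lc 0) (smStep d Lc 0) (∑ w ∈ box (d + 1) (Lc ^ n), Φ 0 (((Lc ^ n : ℕ) : ℤ) • Y + toSite w))) κ' u) u u
          (C₀ * Real.exp (-(min (κ / 2) (δ / 2)) * l1 (((Lc : ℕ) : ℤ) • Y - u))) (κ / 4))
    -- the untransported level: profile under the faces of the `Lc`-block of `Y`
    (hS0 : ∀ m, m + 1 = n → ∀ k' u x z a b, |unitS (sfStep Lc (m + 1)) (smStep d Lc (m + 1))
        (∑ w ∈ box (d + 1) (Lc ^ 0), σ m (((Lc ^ 0 : ℕ) : ℤ) • Y + toSite w)) k' u x z a b| ≤ Cs * ω0 m u * Real.exp (-m' * (l1 (x - u) + l1 (z - u))))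
    (hω0 : ∀ m, m + 1 = n → ∀ u, 0 ≤ ω0 m u ∧ ω0 m u ≤ ∑ μ : Fin (d + 1),
      (∑ v ∈ ((box (d + 1) Lc).filter (fun v => v μ = Lc - 1)).image (fun v => (Lc : ℤ) • Y + toSite v), Real.exp (-δ * l1 (v - u))
        + ∑ v ∈ ((box (d + 1) Lc).filter (fun v => v μ = 0)).image (fun v => (Lc : ℤ) • Y + toSite v - unitVec μ), Real.exp (-δ * l1 (v - u))))
    -- per sub-letter: ff-valued, profile under the faces of its ONE `Lc^(k+1)`-block of label `y_v = Lc•Y + v`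
    (hff : ∀ m k, m + k + 2 = n → ∀ v ∈ box (d + 1) Lc, ∀ κ' u, IsFF (unitS (sfStep Lc (m + 1)) (smStep d Lc (m + 1))
        (∑ w ∈ box (d + 1) (Lc ^ k), σ m (((Lc ^ k : ℕ) : ℤ) • (((Lc : ℕ) : ℤ) • Y + toSite v) + toSite w)) κ' u))
    (hS : ∀ m k, m + k + 2 = n → ∀ v ∈ box (d + 1) Lc, ∀ k' u x z a b, |unitS (sfStep Lc (m + 1)) (smStep d Lc (m + 1))
        (∑ w ∈ box (d + 1) (Lc ^ k), σ m (((Lc ^ k : ℕ) : ℤ) • (((Lc : ℕ) : ℤ) • Y + toSite v) + toSite w)) k' u x z a b|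
      ≤ Cs * ω m v u * Real.exp (-m' * (l1 (x - u) + l1 (z - u))))
    (hω : ∀ m k, m + k + 2 = n → ∀ v ∈ box (d + 1) Lc, ∀ u, 0 ≤ ω m v u ∧ ω m v u ≤ ∑ μ : Fin (d + 1),
      (∑ b ∈ ((box (d + 1) (Lc ^ (k + 1))).filter (fun b => b μ = Lc ^ (k + 1) - 1)).image
          (fun b => ((Lc ^ (k + 1) : ℕ) : ℤ) • (((Lc : ℕ) : ℤ) • Y + toSite v) + toSite b), Real.exp (-δ * l1 (b - u))
        + ∑ b ∈ ((box (d + 1) (Lc ^ (k + 1))).filter (fun b => b μ = 0)).image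
          (fun b => ((Lc ^ (k + 1) : ℕ) : ℤ) • (((Lc : ℕ) : ℤ) • Y + toSite v) + toSite b - unitVec μ), Real.exp (-δ * l1 (b - u))))
    -- per GOOD sub-letter: the layer bound in leaf-01's `(L = Lc^(k+1), y_v)` currency
    (hLT : ∀ m k, m + k + 2 = n → ∀ v ∈ box (d + 1) Lc, G m v → ∀ ν U, BiLoc (((((Lc ^ (k + 1) : ℕ) : ℝ)) ^ (3 * (d + 1))) •
        push₃ (legChain (respStepBmSeq (toSite rr) Lc) (m + 1) k) (legChain (respStepBmSeq (toSite rr) Lc) (m + 1) k) (legChain (respStepBmSeq (toSite rr) Lc) (m + 1) k)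
          (unitS (sfStep Lc (m + 1)) (smStep d Lc (m + 1))
            (∑ w ∈ box (d + 1) (Lc ^ k), σ m (((Lc ^ k : ℕ) : ℤ) • (((Lc : ℕ) : ℤ) • Y + toSite v) + toSite w))) ν U) U U
        (K * θ ^ (k + 1) * Real.exp (-(min (κ / 2) (δ / 2)) * l1 ((((Lc : ℕ) : ℤ) • Y + toSite v) - U))) (κ / 4))
    -- the displayed remainder: the transported BAD sub-letters
    {DL : Fin (d + 1) → (Fin (d + 1) → ℤ) → MKer (d + 1) (Fib d)}
    (hDL : DL = ∑ m ∈ (Finset.range n).filter (fun m => m + 2 ≤ n), ∑ v ∈ (box (d + 1) Lc).filter (fun v => ¬ G m v),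
      transport (unitStepMap Lc (toSite rr) ((Lc : ℝ) ^ (d + 1))) (m + 1) (n - 1 - m)
        (unitS (sfStep Lc (m + 1)) (smStep d Lc (m + 1))
          (∑ w ∈ box (d + 1) (Lc ^ (n - 2 - m)), σ m (((Lc ^ (n - 2 - m) : ℕ) : ℤ) • (((Lc : ℕ) : ℤ) • Y + toSite v) + toSite w)))) :
    ∀ κ' u, BiLoc ((unitS (sfStep Lc n) (smStep d Lc n) (Φ n Y) - DL) κ' u) u u
      ((C₀ + (((box (d + 1) Lc).card : ℝ) * Real.exp (δ * (((d : ℝ) + 1) * Lc + 1)) * (K + Cs * (((d : ℝ) + 1) * (2 * ((box (d + 1) Lc).card : ℝ)))))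
        * (1 - θ)⁻¹) * Real.exp (-(min (κ / 2) (δ / 2)) * l1 (((Lc : ℕ) : ℤ) • Y - u))) (κ / 4) := by
  set η : ℝ := min (κ / 2) (δ / 2) with hη
  have hη0 : 0 ≤ η := le_min (by linarith) (by linarith)
  have hηδ : η ≤ δ := (min_le_right _ _).trans (by linarith)
  set B : ℝ := ((box (d + 1) Lc).card : ℝ) with hB
  set E : ℝ := Real.exp (δ * (((d : ℝ) + 1) * Lc + 1)) with hE
  have hB0 : 0 ≤ B := by rw [hB]; positivity
  have hE1 : 1 ≤ E := by rw [hE]; exact Real.one_le_exp (by positivity)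
  have hK1 : 0 ≤ Cs * (((d : ℝ) + 1) * (2 * B)) := by positivity
  have hC : 0 ≤ B * E * (K + Cs * (((d : ℝ) + 1) * (2 * B))) := by positivity
  -- the transported level terms (unit currency) and the bad parts
  set T : ℕ → Fin (d + 1) → (Fin (d + 1) → ℤ) → MKer (d + 1) (Fib d) := fun m =>
    transport (unitStepMap Lc (toSite rr) ((Lc : ℝ) ^ (d + 1))) (m + 1) (n - 1 - m)
      (unitS (sfStep Lc (m + 1)) (smStep d Lc (m + 1)) (∑ w ∈ box (d + 1) (Lc ^ (n - 1 - m)), σ m (((Lc ^ (n - 1 - m) : ℕ) : ℤ) • Y + toSite w))) with hT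
  set Dm : ℕ → Fin (d + 1) → (Fin (d + 1) → ℤ) → MKer (d + 1) (Fib d) := fun m =>
    if m + 2 ≤ n then ∑ v ∈ (box (d + 1) Lc).filter (fun v => ¬ G m v),
      transport (unitStepMap Lc (toSite rr) ((Lc : ℝ) ^ (d + 1))) (m + 1) (n - 1 - m)
        (unitS (sfStep Lc (m + 1)) (smStep d Lc (m + 1))
          (∑ w ∈ box (d + 1) (Lc ^ (n - 2 - m)), σ m (((Lc ^ (n - 2 - m) : ℕ) : ℤ) • (((Lc : ℕ) : ℤ) • Y + toSite v) + toSite w))) else 0 with hDm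
  have hdu := unitS_duhamel_blockSum_comb (toSite rr) n Y hunroll
  have key : unitS (sfStep Lc n) (smStep d Lc n) (Φ n Y) - DL
      = transport (unitStepMap Lc (toSite rr) ((Lc : ℝ) ^ (d + 1))) 0 n
          (unitS (sfStep Lc 0) (smStep d Lc 0) (∑ w ∈ box (d + 1) (Lc ^ n), Φ 0 (((Lc ^ n : ℕ) : ℤ) • Y + toSite w)))
        + ∑ m ∈ Finset.range n, (T m - Dm m) := by
    rw [hdu, hDL, Finset.sum_filter, Finset.sum_sub_distrib, add_sub_assoc]
  -- the subadditive size class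
  obtain ⟨h0, hadd, hmono⟩ := wLocStencil_good (d := d) (fun (_ : Fin (d + 1)) u => Real.exp (-η * l1 (((Lc : ℕ) : ℤ) • Y - u)))
    (fun _ u => (Real.exp_pos _).le) (κ / 4)
  have hmain : ∀ κ' u, BiLoc ((∑ m ∈ Finset.range n, (T m - Dm m)) κ' u) u u
      ((B * E * (K + Cs * (((d : ℝ) + 1) * (2 * B))) * (1 - θ)⁻¹) * Real.exp (-η * l1 (((Lc : ℕ) : ℤ) • Y - u))) (κ / 4) := by
    refine good_sum_range_of_geometric
      (fun (X : Fin (d + 1) → (Fin (d + 1) → ℤ) → MKer (d + 1) (Fib d)) c => ∀ κ₁ u₁, BiLoc (X κ₁ u₁) u₁ u₁ (c * Real.exp (-η * l1 (((Lc : ℕ) : ℤ) • Y - u₁))) (κ / 4))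
      h0 hadd hmono hθ0 hθ1 hC n (fun m => T m - Dm m) ?_
    intro m hmr κ' u
    show BiLoc ((T m - Dm m) κ' u) u u (B * E * (K + Cs * (((d : ℝ) + 1) * (2 * B))) * θ ^ (n - 1 - m) * Real.exp (-η * l1 (((Lc : ℕ) : ℤ) • Y - u))) (κ / 4)
    have he0 : 0 ≤ Real.exp (-η * l1 (((Lc : ℕ) : ℤ) • Y - u)) := (Real.exp_pos _).le
    obtain ⟨k, hk⟩ : ∃ k, n - 1 - m = k := ⟨_, rfl⟩
    rcases k with _ | k
    · -- the untransported level `m = n − 1`: no sub-letters, `Dm m = 0`; faces of the `Lc`-block of `Y`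
      have hmk : m + 1 = n := by have := Finset.mem_range.1 hmr; omega
      have hD0 : Dm m = 0 := by rw [hDm]; exact if_neg (by omega)
      have h := biLoc_of_profile_block hCs hδ.le hηδ (r := κ / 4) (by linarith) (hS0 m hmk) Lc Y (hω0 m hmk) κ' u
      rw [hD0, sub_zero, hT]
      show BiLoc (transport (unitStepMap Lc (toSite rr) ((Lc : ℝ) ^ (d + 1))) (m + 1) (n - 1 - m)
        (unitS (sfStep Lc (m + 1)) (smStep d Lc (m + 1)) (∑ w ∈ box (d + 1) (Lc ^ (n - 1 - m)), σ m (((Lc ^ (n - 1 - m) : ℕ) : ℤ) • Y + toSite w))) κ' u) u u _ _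
      rw [hk, transport_zero]
      refine biLoc_weaken h ?_ le_rfl
      show _ ≤ B * E * (K + Cs * (((d : ℝ) + 1) * (2 * B))) * θ ^ 0 * Real.exp (-η * l1 (((Lc : ℕ) : ℤ) • Y - u))
      rw [pow_zero, mul_one]
      have h1 : Cs * (((d : ℝ) + 1) * (2 * B) * E) ≤ B * E * (K + Cs * (((d : ℝ) + 1) * (2 * B))) := by
        have hB1 : 1 ≤ B := by rw [hB]; exact_mod_cast Finset.card_pos.2 ⟨rr, hrr⟩
        nlinarith [mul_nonneg hB0 (mul_nonneg (by positivity : (0:ℝ) ≤ E) hK), mul_nonneg hK1 (by positivity : (0:ℝ) ≤ E)]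
      nlinarith
    · -- `k + 1 ≥ 1` transported levels: split into sub-letters, subtract the bad ones, bound the good ones by `hLT`
      have hmk2 : m + k + 2 = n := by have := Finset.mem_range.1 hmr; omega
      have hk2 : n - 2 - m = k := by omega
      have hle : m + 2 ≤ n := by omega
      -- every raw sub-letter sum is in the class (its displayed unit profile + the inverse units)
      have hl : ∀ v ∈ box (d + 1) Lc, ∃ Cs' δ' : ℝ, 0 < δ' ∧
          LocStencil (∑ w ∈ box (d + 1) (Lc ^ k), σ m (((Lc ^ k : ℕ) : ℤ) • (((Lc : ℕ) : ℤ) • Y + toSite v) + toSite w)) Cs' δ' := fun v hv =>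
        isLoc_of_isLoc_unitS (sfStep_ne_zero (m + 1)) (smStep_ne_zero (d := d) (m + 1))
          ⟨_, _, hκ.trans hm, locStencil_of_profile hCs hδ.le (hS m k hmk2 v hv) _ (hω m k hmk2 v hv)⟩
      -- the level term minus its bad part = the good part
      have hgood : T m - Dm m = ∑ v ∈ (box (d + 1) Lc).filter (fun v => G m v),
          transport (unitStepMap Lc (toSite rr) ((Lc : ℝ) ^ (d + 1))) (m + 1) (k + 1)
            (unitS (sfStep Lc (m + 1)) (smStep d Lc (m + 1))
              (∑ w ∈ box (d + 1) (Lc ^ k), σ m (((Lc ^ k : ℕ) : ℤ) • (((Lc : ℕ) : ℤ) • Y + toSite v) + toSite w))) := by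
        rw [hT, hDm]
        simp only [if_pos hle]
        rw [hk, hk2, transport_unitS_blockSum_split hrr _ m k Y (σ m) hl]
        exact sum_filter_sub (box (d + 1) Lc) (G m) _
      rw [hgood]
      -- each good sub-letter's transport, rewritten as the cubic push and bounded
      have hterm : ∀ v ∈ (box (d + 1) Lc).filter (fun v => G m v), BiLoc (transport (unitStepMap Lc (toSite rr) ((Lc : ℝ) ^ (d + 1))) (m + 1) (k + 1)
          (unitS (sfStep Lc (m + 1)) (smStep d Lc (m + 1))
            (∑ w ∈ box (d + 1) (Lc ^ k), σ m (((Lc ^ k : ℕ) : ℤ) • (((Lc : ℕ) : ℤ) • Y + toSite v) + toSite w))) κ' u) u u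
          (K * θ ^ (k + 1) * E * Real.exp (-η * l1 (((Lc : ℕ) : ℤ) • Y - u))) (κ / 4) := by
        intro v hv'
        obtain ⟨hv, hG⟩ := Finset.mem_filter.1 hv'
        have hSl := locStencil_of_profile hCs hδ.le (hS m k hmk2 v hv) _ (hω m k hmk2 v hv)
        have h := hLT m k hmk2 v hv hG κ' u
        intro x z a b
        rw [transport_unitStepMap_eq_cubic_push₃ hrr (m + 1) k (hff m k hmk2 v hv) ⟨_, _, hκ.trans hm, hSl⟩ κ' u]
        refine (h x z a b).trans (mul_le_mul_of_nonneg_right ?_ (Real.exp_pos _).le)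
        have hdist : l1 (((Lc : ℕ) : ℤ) • Y - u) ≤ l1 ((((Lc : ℕ) : ℤ) • Y + toSite v) - u) + (((d : ℝ) + 1) * Lc + 1) := by
          have h1 := l1_sub_triangle (((Lc : ℕ) : ℤ) • Y) (((Lc : ℕ) : ℤ) • Y + toSite v) u
          have h2 : l1 (((Lc : ℕ) : ℤ) • Y - (((Lc : ℕ) : ℤ) • Y + toSite v)) ≤ ((d : ℝ) + 1) * Lc := by
            rw [l1_sub_symm, show ((Lc : ℕ) : ℤ) • Y + toSite v - ((Lc : ℕ) : ℤ) • Y = toSite v by abel]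
            exact l1_toSite_le hv
          linarith
        have hexp : Real.exp (-η * l1 ((((Lc : ℕ) : ℤ) • Y + toSite v) - u)) ≤ E * Real.exp (-η * l1 (((Lc : ℕ) : ℤ) • Y - u)) := by
          have h4 : Real.exp (η * (((d : ℝ) + 1) * Lc + 1)) ≤ E := by rw [hE]; exact Real.exp_le_exp.2 (by nlinarith [show (0:ℝ) ≤ ((d:ℝ)+1) * Lc + 1 by positivity])
          refine le_trans ?_ (mul_le_mul_of_nonneg_right h4 (Real.exp_pos _).le)
          rw [← Real.exp_add]; exact Real.exp_le_exp.2 (by nlinarith)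
        calc K * θ ^ (k + 1) * Real.exp (-η * l1 ((((Lc : ℕ) : ℤ) • Y + toSite v) - u)) ≤ K * θ ^ (k + 1) * (E * Real.exp (-η * l1 (((Lc : ℕ) : ℤ) • Y - u))) :=
              mul_le_mul_of_nonneg_left hexp (mul_nonneg hK (pow_nonneg hθ0 _))
          _ = K * θ ^ (k + 1) * E * Real.exp (-η * l1 (((Lc : ℕ) : ℤ) • Y - u)) := by ring
      have hsum := biLoc_finset_sum ((box (d + 1) Lc).filter (fun v => G m v)) (p := u) (q := u) (δ := κ / 4)
        (K := fun v => transport (unitStepMap Lc (toSite rr) ((Lc : ℝ) ^ (d + 1))) (m + 1) (k + 1)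
          (unitS (sfStep Lc (m + 1)) (smStep d Lc (m + 1))
            (∑ w ∈ box (d + 1) (Lc ^ k), σ m (((Lc ^ k : ℕ) : ℤ) • (((Lc : ℕ) : ℤ) • Y + toSite v) + toSite w))) κ' u)
        (C := fun _ => K * θ ^ (k + 1) * E * Real.exp (-η * l1 (((Lc : ℕ) : ℤ) • Y - u))) hterm
      rw [Finset.sum_const, nsmul_eq_mul] at hsum
      rw [Finset.sum_apply, Finset.sum_apply]
      refine biLoc_weaken hsum ?_ le_rfl
      show (((box (d + 1) Lc).filter (fun v => G m v)).card : ℝ) * (K * θ ^ (k + 1) * E * Real.exp (-η * l1 (((Lc : ℕ) : ℤ) • Y - u)))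
        ≤ B * E * (K + Cs * (((d : ℝ) + 1) * (2 * B))) * θ ^ (n - 1 - m) * Real.exp (-η * l1 (((Lc : ℕ) : ℤ) • Y - u))
      rw [hk]
      have hθk : 0 ≤ θ ^ (k + 1) := pow_nonneg hθ0 _
      have hcard : (((box (d + 1) Lc).filter (fun v => G m v)).card : ℝ) ≤ B := card_filter_le_real _ _
      have hpos : 0 ≤ K * θ ^ (k + 1) * E * Real.exp (-η * l1 (((Lc : ℕ) : ℤ) • Y - u)) := by positivity
      calc (((box (d + 1) Lc).filter (fun v => G m v)).card : ℝ) * (K * θ ^ (k + 1) * E * Real.exp (-η * l1 (((Lc : ℕ) : ℤ) • Y - u)))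
          ≤ B * (K * θ ^ (k + 1) * E * Real.exp (-η * l1 (((Lc : ℕ) : ℤ) • Y - u))) := mul_le_mul_of_nonneg_right hcard hpos
        _ ≤ B * E * (K + Cs * (((d : ℝ) + 1) * (2 * B))) * θ ^ (k + 1) * Real.exp (-η * l1 (((Lc : ℕ) : ℤ) • Y - u)) := by
          nlinarith [mul_nonneg (mul_nonneg (mul_nonneg hB0 (by positivity : (0:ℝ) ≤ E)) (mul_nonneg hK1 hθk)) he0]
  intro κ' u
  rw [key]
  exact hadd _ _ _ _ hΦ0 hmain κ' u

/-! ## §3 `d = 3`: the literal-socket currency -/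

/-- NOT IN PRINT; OUR BOOKKEEPING.  **THE (Q-R)^{cc} RE-CUT AT `d = 3`** — §2 with `θ = (√Lc)⁻¹` (`2 ≤ Lc`) and the good sub-letters' layer bound displayed in leaf-01's literal-socket
currency `K·((√(((Lc^(k+1):ℕ):ℝ)))⁻¹·e^{−η‖y_v − U‖₁})` (token-exact the conclusion of `LayerTransportLiteralSocket.exists_hLT_literal_of_gauge_cells`), asked ONLY for `G m v`; the
transported bad sub-letters displayed as `DL` (`hDL`).  Constant `(C₀ + #box(Lc)·e^{δ(4Lc+1)}·(K + 8·#box(Lc)·Cs)·(1 − (√Lc)⁻¹)⁻¹)·e^{−η‖Lc•Y − u‖₁}` — UNIFORM IN `n`. -/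
theorem wLocStencil_unitS_coDress_three {rr : Fin (3 + 1) → ℕ} (hrr : rr ∈ box (3 + 1) Lc) (hLc : 2 ≤ Lc)
    (G : ℕ → (Fin (3 + 1) → ℕ) → Prop) [∀ m, DecidablePred (G m)]
    {Φ σ : ℕ → (Fin (3 + 1) → ℤ) → Fin (3 + 1) → (Fin (3 + 1) → ℤ) → MKer (3 + 1) (Fib 3)} (n : ℕ) (Y : Fin (3 + 1) → ℤ)
    {ω0 : ℕ → (Fin (3 + 1) → ℤ) → ℝ} {ω : ℕ → (Fin (3 + 1) → ℕ) → (Fin (3 + 1) → ℤ) → ℝ} {Cs κ m' δ K C₀ : ℝ}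
    (hκ : 0 < κ) (hm : κ < m') (hδ : 0 < δ) (hCs : 0 ≤ Cs) (hK : 0 ≤ K)
    (hunroll : Φ n Y =
      transport (fun j (S : Fin (3 + 1) → (Fin (3 + 1) → ℤ) → MKer (3 + 1) (Fib 3)) =>
          fun κ' u' => ((Lc : ℝ) ^ (3 + 1) * wE 3 Lc (j + 1)) • e3OfK Lc (coDressKBmAt (toSite rr) Lc (KInvStep (d := 3) Lc j)) S κ' u') 0 n
          (∑ w ∈ box (3 + 1) (Lc ^ n), Φ 0 (((Lc ^ n : ℕ) : ℤ) • Y + toSite w))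
      + ∑ m ∈ Finset.range n,
          transport (fun j (S : Fin (3 + 1) → (Fin (3 + 1) → ℤ) → MKer (3 + 1) (Fib 3)) =>
              fun κ' u' => ((Lc : ℝ) ^ (3 + 1) * wE 3 Lc (j + 1)) • e3OfK Lc (coDressKBmAt (toSite rr) Lc (KInvStep (d := 3) Lc j)) S κ' u') (m + 1) (n - 1 - m)
            (∑ w ∈ box (3 + 1) (Lc ^ (n - 1 - m)), σ m (((Lc ^ (n - 1 - m) : ℕ) : ℤ) • Y + toSite w)))
    (hΦ0 : ∀ κ' u, BiLoc (transport (unitStepMap Lc (toSite rr) ((Lc : ℝ) ^ (3 + 1))) 0 n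
          (unitS (sfStep Lc 0) (smStep 3 Lc 0) (∑ w ∈ box (3 + 1) (Lc ^ n), Φ 0 (((Lc ^ n : ℕ) : ℤ) • Y + toSite w))) κ' u) u u
          (C₀ * Real.exp (-(min (κ / 2) (δ / 2)) * l1 (((Lc : ℕ) : ℤ) • Y - u))) (κ / 4))
    (hS0 : ∀ m, m + 1 = n → ∀ k' u x z a b, |unitS (sfStep Lc (m + 1)) (smStep 3 Lc (m + 1))
        (∑ w ∈ box (3 + 1) (Lc ^ 0), σ m (((Lc ^ 0 : ℕ) : ℤ) • Y + toSite w)) k' u x z a b| ≤ Cs * ω0 m u * Real.exp (-m' * (l1 (x - u) + l1 (z - u))))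
    (hω0 : ∀ m, m + 1 = n → ∀ u, 0 ≤ ω0 m u ∧ ω0 m u ≤ ∑ μ : Fin (3 + 1),
      (∑ v ∈ ((box (3 + 1) Lc).filter (fun v => v μ = Lc - 1)).image (fun v => (Lc : ℤ) • Y + toSite v), Real.exp (-δ * l1 (v - u))
        + ∑ v ∈ ((box (3 + 1) Lc).filter (fun v => v μ = 0)).image (fun v => (Lc : ℤ) • Y + toSite v - unitVec μ), Real.exp (-δ * l1 (v - u))))
    (hff : ∀ m k, m + k + 2 = n → ∀ v ∈ box (3 + 1) Lc, ∀ κ' u, IsFF (unitS (sfStep Lc (m + 1)) (smStep 3 Lc (m + 1))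
        (∑ w ∈ box (3 + 1) (Lc ^ k), σ m (((Lc ^ k : ℕ) : ℤ) • (((Lc : ℕ) : ℤ) • Y + toSite v) + toSite w)) κ' u))
    (hS : ∀ m k, m + k + 2 = n → ∀ v ∈ box (3 + 1) Lc, ∀ k' u x z a b, |unitS (sfStep Lc (m + 1)) (smStep 3 Lc (m + 1))
        (∑ w ∈ box (3 + 1) (Lc ^ k), σ m (((Lc ^ k : ℕ) : ℤ) • (((Lc : ℕ) : ℤ) • Y + toSite v) + toSite w)) k' u x z a b|
      ≤ Cs * ω m v u * Real.exp (-m' * (l1 (x - u) + l1 (z - u))))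
    (hω : ∀ m k, m + k + 2 = n → ∀ v ∈ box (3 + 1) Lc, ∀ u, 0 ≤ ω m v u ∧ ω m v u ≤ ∑ μ : Fin (3 + 1),
      (∑ b ∈ ((box (3 + 1) (Lc ^ (k + 1))).filter (fun b => b μ = Lc ^ (k + 1) - 1)).image
          (fun b => ((Lc ^ (k + 1) : ℕ) : ℤ) • (((Lc : ℕ) : ℤ) • Y + toSite v) + toSite b), Real.exp (-δ * l1 (b - u))
        + ∑ b ∈ ((box (3 + 1) (Lc ^ (k + 1))).filter (fun b => b μ = 0)).image
          (fun b => ((Lc ^ (k + 1) : ℕ) : ℤ) • (((Lc : ℕ) : ℤ) • Y + toSite v) + toSite b - unitVec μ), Real.exp (-δ * l1 (b - u))))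
    -- per GOOD sub-letter: leaf-01's ONE-BLOCK cell in its literal-socket currency
    (hLT : ∀ m k, m + k + 2 = n → ∀ v ∈ box (3 + 1) Lc, G m v → ∀ ν U, BiLoc (((((Lc ^ (k + 1) : ℕ) : ℝ)) ^ (3 * (3 + 1))) •
        push₃ (legChain (respStepBmSeq (toSite rr) Lc) (m + 1) k) (legChain (respStepBmSeq (toSite rr) Lc) (m + 1) k) (legChain (respStepBmSeq (toSite rr) Lc) (m + 1) k)
          (unitS (sfStep Lc (m + 1)) (smStep 3 Lc (m + 1))
            (∑ w ∈ box (3 + 1) (Lc ^ k), σ m (((Lc ^ k : ℕ) : ℤ) • (((Lc : ℕ) : ℤ) • Y + toSite v) + toSite w))) ν U) U U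
        (K * ((Real.sqrt (((Lc ^ (k + 1) : ℕ) : ℝ)))⁻¹ * Real.exp (-(min (κ / 2) (δ / 2)) * l1 ((((Lc : ℕ) : ℤ) • Y + toSite v) - U)))) (κ / 4))
    {DL : Fin (3 + 1) → (Fin (3 + 1) → ℤ) → MKer (3 + 1) (Fib 3)}
    (hDL : DL = ∑ m ∈ (Finset.range n).filter (fun m => m + 2 ≤ n), ∑ v ∈ (box (3 + 1) Lc).filter (fun v => ¬ G m v),
      transport (unitStepMap Lc (toSite rr) ((Lc : ℝ) ^ (3 + 1))) (m + 1) (n - 1 - m)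
        (unitS (sfStep Lc (m + 1)) (smStep 3 Lc (m + 1))
          (∑ w ∈ box (3 + 1) (Lc ^ (n - 2 - m)), σ m (((Lc ^ (n - 2 - m) : ℕ) : ℤ) • (((Lc : ℕ) : ℤ) • Y + toSite v) + toSite w)))) :
    ∀ κ' u, BiLoc ((unitS (sfStep Lc n) (smStep 3 Lc n) (Φ n Y) - DL) κ' u) u u
      ((C₀ + (((box (3 + 1) Lc).card : ℝ) * Real.exp (δ * (((3 : ℝ) + 1) * Lc + 1)) * (K + Cs * (((3 : ℝ) + 1) * (2 * ((box (3 + 1) Lc).card : ℝ)))))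
        * (1 - (Real.sqrt (Lc : ℝ))⁻¹)⁻¹) * Real.exp (-(min (κ / 2) (δ / 2)) * l1 (((Lc : ℕ) : ℤ) • Y - u))) (κ / 4) := by
  have hLc1 : (1 : ℝ) < (Lc : ℝ) := by exact_mod_cast hLc
  have hs1 : 1 < Real.sqrt (Lc : ℝ) := by
    rw [show (1 : ℝ) = Real.sqrt 1 from Real.sqrt_one.symm]
    exact Real.sqrt_lt_sqrt zero_le_one hLc1
  have e3 : ((3 : ℕ) : ℝ) = (3 : ℝ) := by norm_num
  have h := wLocStencil_unitS_of_layer_coDress hrr G n Y hκ hm hδ hCs hK (inv_nonneg.2 (Real.sqrt_nonneg _)) (inv_lt_one_of_one_lt₀ hs1) hunroll hΦ0 hS0 hω0 hff hS hω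
    (fun m k hmk v hv hG ν U => by rw [← inv_sqrt_natCast_pow, mul_assoc]; exact hLT m k hmk v hv hG ν U) hDL
  rw [e3] at h
  exact h

/-! ## §4 Row (CC): on a co-closed letter the literal socket needs only the two KERNEL one-gauge cells -/

/-- NOT IN PRINT; OUR BOOKKEEPING (`LayerTransportLiteralSocket.exists_hLT_literal_of_gauge_cells` ⨾ `ChainTableLegTelescopeCell.biLoc_smul_push₃_chainGauge_of_divFree`).  **ROW (CC):
THE GOOD SUB-LETTERS' `hLT` FROM TWO KERNEL ONE-GAUGE CELLS.**  `d = 3`, `2 ≤ Lc`: there are `κ₀ > 0`, `A A′ A″ ≥ 0` (leaf-02's, level-free) such that for every `0 < κ ≤ κ₀`, every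
`(m, k)`, every CO-CLOSED slot-summable letter `S` (`divV S ≡ 0`) meeting the letter-side rows of the (LT-3) END at `κ`, and ANY two constants `K₁ K₂` with the KERNEL one-gauge cells
`push₃ (T−U) T T S`, `push₃ U (T−U) T S` bi-localised at `U₀` (DISPLAYED — (ii-G)'s objects), the literal's cubic push `push₃ T T T S` satisfies the END's `hLT` with constant
`(K₀ + K₁ + K₂ + 0)·(√(Lc^(k+1)))⁻¹·e^{−η‖y−U₀‖₁}` — the TABLE cell `push₃ U U (T−U) S` is the zero kernel (leaf-01 g67), the pure cell (UUU) discharged inside the socket.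
`T = legChain (respStepBmSeq ρ Lc) (m+1) k`, `U = respStep (Lc^(m+1)) (Lc^(m+1+k+1))`. -/
theorem exists_hLT_literal_of_kernel_cells_of_divFree (hLc : 2 ≤ Lc) {rr : Fin (3 + 1) → ℕ} (hrr : rr ∈ box (3 + 1) Lc) :
    ∃ κ₀ A A' A'' : ℝ, 0 < κ₀ ∧ 0 ≤ A ∧ 0 ≤ A' ∧ 0 ≤ A'' ∧
      ∀ (m k : ℕ) (κ : ℝ), 0 < κ → κ ≤ κ₀ →
      ∀ (S : Fin (3 + 1) → (Fin (3 + 1) → ℤ) → MKer (3 + 1) (Fib 3)) (ω : (Fin (3 + 1) → ℤ) → ℝ)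
        (Z : Fin (3 + 1) → Fin (3 + 1) → Fin (3 + 1) → (Fin (3 + 1) → ℤ) → (Fin (3 + 1) → ℤ) → ℝ) (T' : Finset (Fin (3 + 1) → ℤ))
        (Cs Csl m' δ B δZ ρ CT : ℝ), κ < m' → 0 < δ → 0 ≤ Cs → 0 ≤ B → 4 * κ < δZ →
        LocStencil S Csl m' →
        (∀ κ₁ x z a b, Summable fun u => S κ₁ u x z a b) →
        (∀ u, divV S u = 0) →
        (∀ k' u x z a b, |S k' u x z a b| ≤ Cs * ω u * Real.exp (-m' * (l1 (x - u) + l1 (z - u)))) →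
        ∀ (y : Fin (3 + 1) → ℤ),
        (∀ u, 0 ≤ ω u ∧ ω u ≤ ∑ μ : Fin (3 + 1),
          (∑ v ∈ ((box (3 + 1) (Lc ^ (k + 1))).filter (fun v => v μ = Lc ^ (k + 1) - 1)).image (fun v => ((Lc ^ (k + 1) : ℕ) : ℤ) • y + toSite v),
              Real.exp (-δ * l1 (v - u))
            + ∑ v ∈ ((box (3 + 1) (Lc ^ (k + 1))).filter (fun v => v μ = 0)).image (fun v => ((Lc ^ (k + 1) : ℕ) : ℤ) • y + toSite v - unitVec μ),
                Real.exp (-δ * l1 (v - u)))) →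
        (∀ k' κ₁ κ₂ u, ∑' x, ∑' z, S k' u x z (Sum.inl κ₁) (Sum.inl κ₂) = ∑ y' ∈ T', Z k' κ₁ κ₂ y' u) →
        (∀ k' κ₁ κ₂, ∀ y' ∈ T', ∀ e, |Z k' κ₁ κ₂ y' e| ≤ B * Real.exp (-δZ * l1 (e - y'))) →
        (∀ k' κ₁ κ₂, ∀ y' ∈ T', ∑' e, Z k' κ₁ κ₂ y' e = 0) →
        (∀ k' κ₁ κ₂, ∀ y' ∈ T', ∀ i : Fin (3 + 1), ∑' e, (((e - y') i : ℤ) : ℝ) * Z k' κ₁ κ₂ y' e = 0) →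
        (∀ y' ∈ T', l1 (quo (Lc ^ (k + 1)) y' - y) ≤ ρ) → ((T'.card : ℝ) ≤ CT * (((Lc ^ (k + 1) : ℕ) : ℝ)) ^ (3 + 1)) →
        ∀ (K₁ K₂ : ℝ) (ν : Fin (3 + 1)) (U₀ : Fin (3 + 1) → ℤ),
        BiLoc (((((Lc ^ (k + 1) : ℕ) : ℝ)) ^ (3 * (3 + 1))) •
            push₃ (legChain (respStepBmSeq (d := 3) (toSite rr) Lc) (m + 1) k - respStep (d := 3) (Lc ^ (m + 1)) (Lc ^ (m + 1 + k + 1)))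
              (legChain (respStepBmSeq (d := 3) (toSite rr) Lc) (m + 1) k) (legChain (respStepBmSeq (d := 3) (toSite rr) Lc) (m + 1) k) S ν U₀) U₀ U₀
          (K₁ * ((Real.sqrt (((Lc ^ (k + 1) : ℕ) : ℝ)))⁻¹ * Real.exp (-(min (κ / 2) (δ / 2)) * l1 (y - U₀)))) (κ / 4) →
        BiLoc (((((Lc ^ (k + 1) : ℕ) : ℝ)) ^ (3 * (3 + 1))) •
            push₃ (respStep (d := 3) (Lc ^ (m + 1)) (Lc ^ (m + 1 + k + 1)))
              (legChain (respStepBmSeq (d := 3) (toSite rr) Lc) (m + 1) k - respStep (d := 3) (Lc ^ (m + 1)) (Lc ^ (m + 1 + k + 1)))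
              (legChain (respStepBmSeq (d := 3) (toSite rr) Lc) (m + 1) k) S ν U₀) U₀ U₀
          (K₂ * ((Real.sqrt (((Lc ^ (k + 1) : ℕ) : ℝ)))⁻¹ * Real.exp (-(min (κ / 2) (δ / 2)) * l1 (y - U₀)))) (κ / 4) →
        BiLoc (((((Lc ^ (k + 1) : ℕ) : ℝ)) ^ (3 * (3 + 1))) •
            push₃ (legChain (respStepBmSeq (d := 3) (toSite rr) Lc) (m + 1) k) (legChain (respStepBmSeq (d := 3) (toSite rr) Lc) (m + 1) k)
              (legChain (respStepBmSeq (d := 3) (toSite rr) Lc) (m + 1) k) S ν U₀) U₀ U₀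
          (((((((3 : ℝ) + 1) ^ 3 * A ^ 2 * A' * Cs * (2 / (m' - κ) * Zl (3 + 1) ((m' - κ) / 2)) * (Zl (3 + 1) (m' - κ) + Zl (3 + 1) m'))
            * ((2 * ((3 : ℝ) + 1)) ^ 2 * Zl (3 + 1) (δ / 2) * Real.exp (min (κ / 2) (δ / 2))))
        + ((3 : ℝ) + 1) ^ 3 *
          ((((A'' * A * A + 2 * A' * A' * A + A * A'' * A) * Real.exp (2 * κ) + 2 * ((A' * A + A * A') * Real.exp κ) * A' + A * A * A'')
              * Real.exp (2 * (2 * κ))) * B * (8 / (δZ - 2 * (2 * κ)) ^ 2 * Zl (3 + 1) ((δZ - 2 * (2 * κ)) / 4)) * Real.exp ((κ / 2) * ρ) * CT))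
            + K₁ + K₂ + 0) * ((Real.sqrt (((Lc ^ (k + 1) : ℕ) : ℝ)))⁻¹ * Real.exp (-(min (κ / 2) (δ / 2)) * l1 (y - U₀)))) (κ / 4) := by
  obtain ⟨κ₀, A, A', A'', hκ₀, hA, hA', hA'', h⟩ := exists_hLT_literal_of_gauge_cells (Lc := Lc) hLc hrr
  refine ⟨κ₀, A, A', A'', hκ₀, hA, hA', hA'', ?_⟩
  intro m k κ hκ hκκ₀ S ω Z T' Cs Csl m' δ B δZ ρ CT hm hδ hCs hB hκδZ hSl hSs hdiv hS y hω hQ hZ hM0 hP1 hTl hTcard K₁ K₂ ν U₀ h₁ h₂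
  -- the table one-gauge cell is the zero kernel on a co-closed letter (leaf-01 g67), at the pair `(m+1, k)`
  have h₃ := biLoc_smul_push₃_chainGauge_of_divFree (d := 3) hrr (m + 1) k hSs hdiv
    (respStep (d := 3) (Lc ^ (m + 1)) (Lc ^ (m + 1 + k + 1))) (respStep (d := 3) (Lc ^ (m + 1)) (Lc ^ (m + 1 + k + 1)))
    (((((Lc ^ (k + 1) : ℕ) : ℝ)) ^ (3 * (3 + 1)))) ν U₀ U₀ U₀
    (((Real.sqrt (((Lc ^ (k + 1) : ℕ) : ℝ)))⁻¹ * Real.exp (-(min (κ / 2) (δ / 2)) * l1 (y - U₀)))) (κ / 4)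
  exact h m k κ hκ hκκ₀ S ω Z T' Cs Csl m' δ B δZ ρ CT hm hδ hCs hB hκδZ hSl hS y hω hQ hZ hM0 hP1 hTl hTcard K₁ K₂ 0 ν U₀ h₁ h₂ h₃

end CoDress

end Summit.QuantumFields.BalabanUV.Beta.GAN24.WardRemainderEndThreeCoDress

end
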